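/-
Copyright: the b2b-balaban T⁴-continuum CRUX team, row NE7b leaf lineage `t4-ne7b-formalise-leaf-02` (gen 134). Project licence.
-/
import Summits.QuantumFields.BalabanUV.T4Continuum.Spine.NE7b.BlockSurfaceMultiplicity
import Mathlib.Algebra.Order.BigOperators.Group.Finset
import Mathlib.Data.Fintype.BigOperators

/-!
# THE AVERAGE TERMS' INCIDENCE ON THE TWO-SCALE TORUS, BY VALUE: the bonds entering the one-step block average at a coarse bond `(y, κ)` of
# `(ℤ∕M)^d` are `{(n·y + r + t e_κ, κ) : r ∈ [0,n)^d, t ∈ [0,n)}` on `(ℤ∕nM)^d` — at most `n^{d+1}` bonds per term (`a`), each fine bond in at most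
# `n` terms (`b`) and at most `n` times in one term, every bond an `ℓ¹`-FORWARD displacement of length `≤ (d+1)(n−1)` from the term's reference
# site `n·y` (`D`) — the `(a, b, D)` letters of `…AdmissibleFloorSeminormTerms` ∕ `…TentPartitionTorus` for the AVERAGE family of the (h2) slot's
# full form (row NE7b, node U5c; [folklore] two-scale torus counting, the pattern of `…TorusPlaquetteIncidence` + `…PlaquetteTermDisplacement`)

Cell `pub-balaban`, sub-cell `t4`, spine estimate NE7b (`T4WeightBudget.RelWeightBound`; the cell's OWN estimate — NOT PRINTED in
[Bałaban 1983–89], NOT PROVED).  Crux-route work under `Spine/NE7b/` by a row leaf (`t4-ne7b-formalise-leaf-02`, E-side ∕ key-readings ∕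
lattice-geometry lineage, gen 134) under FREEZE (0)'s crux-prover clause; NOTHING of Bałaban's is named as a Lean object, valued or asserted;
no `T4Continuum/Support` leaf typed; no `def` — the incidence map `ιA` is CARRIED BY ITS CHARACTERISING HYPOTHESIS `hιA` (the pattern of
`…TorusPlaquetteIncidence`'s `ι` and `…BlockSquareCounting`'s block points `n·y + r`), inhabited by the lambda itself in the toy; zero `sorry`.
Imports: `…BlockSurfaceMultiplicity` (`blockPoint_injective`, Mathlib-only) + Mathlib.

WHY (located).  The (h2) slot of the `γ₀` assembly at `k = 1` wants an IMS floor for the FULL form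
`F(B′) = n^{d−2}·Σ_c |(Q₁B′)(c)|² + Σ_P |(∂B′)(P)|²` (`HOME/b2b-balaban-r1/SectE-interface-proof.md` §5.5): two families of LINEAR TERMS of the
bond field — plaquette curls and next-level block averages.  `…AdmissibleFloorSeminormTerms` (AFST) ∕ `…AdmissibleFloorSeminormTwoFamilies`
(AFS2) turn per-family letters `(ℓ, a, b)` (coefficient norm, bonds per term, terms per bond) and the partition's `(λ, μ)` into the floor; the
partition letters need, per term, a displacement letter (`…TentPartitionTorus.hvar_tentZ_torus`'s `hdisp`: every bond of the term an
`ℓ¹`-displacement of length `≤ D` from a reference site).  For the CURL family all of it is typed (`…TorusPlaquetteIncidence`: `a = 4`,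
`b = 2(d−1)`; `…PlaquetteTermDisplacement`: `D = 1` ∕ `hunit`; `…CurlTermsLinear`: `ℓ = 1`).  THIS FILE is the AVERAGE family's incidence
geometry — whatever covariant weights the average carries (an OWNER ∕ (A3) choice: `B7Prop3GeneralLinear.Q0cov` periodised by
`…OneStepAveragePeriodicity`, or `Support/CovariantBlockAveraging.Qcov`), at `k = 1` it reads, at the coarse bond `(y, κ)`, exactly the fine bonds
`(n·y + r + t e_κ, κ)`, `r ∈ [0,n)^d`, `t ∈ [0,n)` (the straight contours of [B5] (1.7)–(1.9) ∕ [B7] (125) from every site of the block `B(y)`).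
The counting is by value and crude where crude suffices: `a = n^{d+1}` (`card_image_le`), `b ≤ n` and `≤ n` appearances of a bond in one term
(both from `blockPoint_injective`: the position `t` on the contour determines the block and the offset), `D = (d+1)(n−1)` with `w⁻ = 0`.

WHAT IS PROVED ([folklore]; `n·M`-torus, `ιA (y, κ) (r, t) = (n·y + r + t e_κ, κ)` by hypothesis `hιA`):
* §1 `snd_avgBonds` (direction `κ`), `fst_avgBonds`, `fst_avgBonds_zero` (the reference bond `ιA j 0` sits at the block point `n·y`).
* §2 **`card_image_avgBonds_le`** — `#image (ιA j) ≤ n^{d+1}` (AFST's `a`).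
* §3 **`card_fibre_avgBonds_le`** — a fine bond occurs at most `n` times in one term (`#{(r,t) : ιA j (r,t) = b} ≤ n`; the coefficient-norm count
  of a later `…AverageTermsLinear`: `ℓ ≤ n·(weight)`); **`card_pairs_through_bond_le`** (`#{(j, (r,t)) : ιA j (r,t) = b} ≤ n`) and
  **`card_terms_through_bond_le`** — a fine bond lies in at most `n` average terms (`#{j : b ∈ image (ιA j)} ≤ n`, AFST's `b`; the sharp value is
  `2`, not needed by value).
* §4 **`exists_displacement_avgBonds`** — `…TentPartitionTorus.hvar_tentZ_torus`'s `hdisp` VERBATIM with `pt := Prod.fst`, `ref j := ιA j 0`,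
  `inc j := univ.image (ιA j)`, `D := (d+1)(n−1)`: `b.1 = (ιA j 0).1 + w⁺ − w⁻`, `w⁺ = r + t𝟙_κ`, `w⁻ = 0`, `Σw⁺ + Σw⁻ ≤ (d+1)(n−1)`.
* §5 toy: `d = 1`, `n = 2`, `M = 3` — `hιA` inhabited by the defining lambda (`rfl`-fed) in §2's and §4's binders (junction by elaboration).

BY VALUE (honest, crude letters; v1.1 = chair δ-X-TAI-1): with `…TentPartitionTorus`'s `hμ` (`μ = (a+1)·2^d`), a later
`ℓ_avg = n^{(d−2)∕2}·n^{−(d+1)}·n`, and the sine partition's PER-UNIT-MOVE letter `λ₁ = π∕(2L_part)` turned into AFST's TERM letter by the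
displacement of §4 — `λ_avg ≤ D·λ₁`, `D = (d+1)(n−1)` — the average family's IMS error is `ε_avg = μℓ²λ_avg²ab ≤ (n^{d+1}+1)·2^d·((d+1)(n−1))²·λ₁²`
against the curl family's `2^d·λ₁²·8(d−1)` (`D = 1` there) — a factor `(n^{d+1}+1)((d+1)(n−1))²∕(8(d−1))`, polynomial in the step `n = L`; the
sharp letters (`b = 2`, `a ≤ 2n^d`, `μ ≤ 3^d`-type for boxes of side `≤ L_part`) are later files if the constant matters.

NOT HERE (honest): the average's coefficient maps and their norm `ℓ` (a later `…AverageTermsLinear`, pattern of `…CurlTermsLinear`); WHICH typed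
operator is print's `Q₁(V)` at `k = 1` and its `n^{d−2}` ∕ `η`-normalisation ((A3) ∕ OWNER; currency Q-leaf05-g157-1); the junction with AFST ∕
AFS2 ∕ TPTo BY IMPORT (met BY SHAPE — the binders above are theirs character for character); `k > 1`; anything of Bałaban's.  BY-NAME EFFECT ON
THE WALL: NONE (three counting letters of the (h2) slot's average family become numbers).  NE7b NOT PRINTED ∕ NOT PROVED; spine PROVED 0∕9;
rung (B)+1 on a FINITE torus — NOT infinite volume, NOT the mass gap, NOT Clay.  HONEST DEPENDENCY: continuum YM on T⁴ ⇐ BetaPertH ∧ nine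
spine estimates (0∕9 proved); BetaPertH ⇐ (D1) ∧ (D4) ∧ CAP+tail; G-an2-4 gates asym, D1 and NE2∕3∕4.
-/

set_option autoImplicit false

namespace Summit.QuantumFields.BalabanUV.T4Continuum.NE7b.TorusAverageIncidence

open Finset
open Summit.QuantumFields.BalabanUV.T4Continuum.NE7b.BlockSurfaceMultiplicity (blockPoint_injective)

variable {d M : ℕ} (n : ℕ)
  (ιA : (Fin d → ZMod M) × Fin d → (Fin d → Fin n) × Fin n → (Fin d → ZMod (n * M)) × Fin d)
  (hιA : ∀ y κ r t, ιA (y, κ) (r, t) =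
    ((fun i => (((y i).val * n + (r i : ℕ) : ℕ) : ZMod (n * M))) + Pi.single κ ((t : ℕ) : ZMod (n * M)), κ))

/-! ## §1 The bonds of an average term -/

include hιA in
/-- The bonds of the average term at the coarse bond `j = (y, κ)` all point in direction `κ`. [folklore] -/
theorem snd_avgBonds (j : (Fin d → ZMod M) × Fin d) (rt : (Fin d → Fin n) × Fin n) : (ιA j rt).2 = j.2 := by
  obtain ⟨y, κ⟩ := j
  obtain ⟨r, t⟩ := rt
  rw [hιA]

include hιA in
/-- The bond `ιA (y, κ) (r, t)` starts at the fine site `n·y + r + t e_κ`. [folklore] -/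
theorem fst_avgBonds (y : Fin d → ZMod M) (κ : Fin d) (r : Fin d → Fin n) (t : Fin n) :
    (ιA (y, κ) (r, t)).1 =
      (fun i => (((y i).val * n + (r i : ℕ) : ℕ) : ZMod (n * M))) + Pi.single κ ((t : ℕ) : ZMod (n * M)) := by
  rw [hιA]

include hιA in
/-- **THE REFERENCE BOND** `ιA (y, κ) 0` (offset `r = 0`, position `t = 0`) starts at the block point `n·y`. [folklore] -/
theorem fst_avgBonds_zero [NeZero n] (y : Fin d → ZMod M) (κ : Fin d) :
    (ιA (y, κ) 0).1 = fun i => (((y i).val * n : ℕ) : ZMod (n * M)) := by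
  rw [show (0 : (Fin d → Fin n) × Fin n) = (fun _ => 0, 0) from rfl, hιA]
  funext i
  simp only [Pi.add_apply, Fin.val_zero, add_zero, Nat.cast_zero, Pi.single_zero, Pi.zero_apply]

/-! ## §2 Bonds per term: `a = n^{d+1}` -/

/-- **BONDS PER AVERAGE TERM**: `#image (ιA j) ≤ n^{d+1}` — the `n^d` block sites times the `n` positions on the contour (AFST's `a`; distinct
bonds are in fact `≤ (2n−1)·n^{d−1}`, not needed). [folklore] -/
theorem card_image_avgBonds_le [DecidableEq (Fin d → ZMod (n * M))] (j : (Fin d → ZMod M) × Fin d) :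
    (univ.image (ιA j)).card ≤ n ^ (d + 1) :=
  card_image_le.trans (by
    rw [card_univ, Fintype.card_prod, Fintype.card_fun, Fintype.card_fin, Fintype.card_fin, pow_succ])

/-! ## §3 Multiplicities: a fine bond occurs `≤ n` times in a term and lies in `≤ n` terms -/

include hιA in
/-- **APPEARANCES OF A BOND IN ONE TERM**: `#{(r, t) : ιA (y, κ) (r, t) = b} ≤ n` — the position `t` determines the offset `r`
(`n·y + r = b.1 − t e_κ`, `blockPoint_injective`). [folklore] -/
theorem card_fibre_avgBonds_le [NeZero M] (hn : 0 < n) (j : (Fin d → ZMod M) × Fin d) (b : (Fin d → ZMod (n * M)) × Fin d) :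
    (univ.filter fun rt : (Fin d → Fin n) × Fin n => ιA j rt = b).card ≤ n := by
  classical
  obtain ⟨y, κ⟩ := j
  calc (univ.filter fun rt : (Fin d → Fin n) × Fin n => ιA (y, κ) rt = b).card
      ≤ (univ : Finset (Fin n)).card := by
        refine Finset.card_le_card_of_injOn (fun rt => rt.2) (fun _ _ => Finset.mem_coe.2 (Finset.mem_univ _)) ?_
        rintro ⟨r₁, t₁⟩ h₁ ⟨r₂, t₂⟩ h₂ ht
        simp only [Finset.coe_filter, Finset.mem_univ, true_and, Set.mem_setOf_eq] at h₁ h₂ ht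
        subst ht
        rw [hιA] at h₁ h₂
        have h12 : (fun i => (((y i).val * n + (r₁ i : ℕ) : ℕ) : ZMod (n * M))) =
            fun i => (((y i).val * n + (r₂ i : ℕ) : ℕ) : ZMod (n * M)) :=
          add_right_cancel ((congrArg Prod.fst h₁).trans (congrArg Prod.fst h₂).symm)
        have h3 := blockPoint_injective n hn (a₁ := (y, r₁)) (a₂ := (y, r₂)) h12
        simp only [Prod.mk.injEq, true_and] at h3
        rw [h3]
    _ = n := by rw [card_univ, Fintype.card_fin]

include hιA in
/-- **PAIRS THROUGH A BOND**: `#{(j, (r, t)) : ιA j (r, t) = b} ≤ n` — the direction of `j` is `b.2`, and the position `t` determines the block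
`y` AND the offset `r` (`n·y + r = b.1 − t e_κ`, `blockPoint_injective`). [folklore] -/
theorem card_pairs_through_bond_le [NeZero M] (hn : 0 < n) (b : (Fin d → ZMod (n * M)) × Fin d) :
    (univ.filter fun p : ((Fin d → ZMod M) × Fin d) × ((Fin d → Fin n) × Fin n) => ιA p.1 p.2 = b).card ≤ n := by
  classical
  calc (univ.filter fun p : ((Fin d → ZMod M) × Fin d) × ((Fin d → Fin n) × Fin n) => ιA p.1 p.2 = b).card
      ≤ (univ : Finset (Fin n)).card := by
        refine Finset.card_le_card_of_injOn (fun p => p.2.2) (fun _ _ => Finset.mem_coe.2 (Finset.mem_univ _)) ?_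
        rintro ⟨⟨y₁, κ₁⟩, r₁, t₁⟩ h₁ ⟨⟨y₂, κ₂⟩, r₂, t₂⟩ h₂ ht
        simp only [Finset.coe_filter, Finset.mem_univ, true_and, Set.mem_setOf_eq] at h₁ h₂ ht
        subst ht
        rw [hιA] at h₁ h₂
        have hκ : κ₁ = κ₂ := (congrArg Prod.snd h₁).trans (congrArg Prod.snd h₂).symm
        subst hκ
        have h12 : (fun i => (((y₁ i).val * n + (r₁ i : ℕ) : ℕ) : ZMod (n * M))) =
            fun i => (((y₂ i).val * n + (r₂ i : ℕ) : ℕ) : ZMod (n * M)) :=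
          add_right_cancel ((congrArg Prod.fst h₁).trans (congrArg Prod.fst h₂).symm)
        have h3 := blockPoint_injective n hn (a₁ := (y₁, r₁)) (a₂ := (y₂, r₂)) h12
        simp only [Prod.mk.injEq] at h3
        obtain ⟨rfl, rfl⟩ := h3
        rfl
    _ = n := by rw [card_univ, Fintype.card_fin]

include hιA in
/-- **TERMS THROUGH A BOND**: a fine bond lies in the average terms of at most `n` coarse bonds — `#{j : b ∈ image (ιA j)} ≤ n` (AFST's `b`;
projection of §3's pairs; the sharp value `2` — a contour of `n` sites meets two blocks — is not needed by value). [folklore] -/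
theorem card_terms_through_bond_le [NeZero M] (hn : 0 < n) (b : (Fin d → ZMod (n * M)) × Fin d) :
    (univ.filter fun j : (Fin d → ZMod M) × Fin d => b ∈ univ.image (ιA j)).card ≤ n := by
  classical
  refine le_trans ?_ (card_pairs_through_bond_le n ιA hιA hn b)
  refine Finset.card_le_card_of_surjOn (fun p => p.1) ?_
  rintro j hj
  simp only [Finset.coe_filter, Finset.mem_univ, true_and, Set.mem_setOf_eq] at hj
  obtain ⟨rt, -, hrt⟩ := Finset.mem_image.1 hj
  refine ⟨(j, rt), ?_, rfl⟩
  simp only [Finset.coe_filter, Finset.mem_univ, true_and, Set.mem_setOf_eq]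
  exact hrt

/-! ## §4 The displacement witnesses: `D = (d+1)(n−1)`, forward moves only -/

include hιA in
/-- **THE AVERAGE TERMS' DISPLACEMENT WITNESSES** — `…TentPartitionTorus.hvar_tentZ_torus`'s `hdisp` with `pt := Prod.fst`, `ref j := ιA j 0`,
`inc j := univ.image (ιA j)`, `D := (d+1)(n−1)`: the bond `ιA (y, κ) (r, t)` starts at `n·y + w⁺ − w⁻` with `w⁺ = r + t𝟙_κ`, `w⁻ = 0`,
`Σw⁺ + Σw⁻ = Σ_ν r_ν + t ≤ d(n−1) + (n−1)`. [folklore] -/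
theorem exists_displacement_avgBonds [NeZero n] [DecidableEq (Fin d → ZMod (n * M))] :
    ∀ j : (Fin d → ZMod M) × Fin d, ∀ b ∈ univ.image (ιA j), ∃ wp wm : Fin d → ℕ,
      Prod.fst b = Prod.fst (ιA j 0) + (fun ν => ((wp ν : ℕ) : ZMod (n * M))) - (fun ν => ((wm ν : ℕ) : ZMod (n * M))) ∧
        ∑ ν, wp ν + ∑ ν, wm ν ≤ (d + 1) * (n - 1) := by
  rintro ⟨y, κ⟩ b hb
  obtain ⟨⟨r, t⟩, -, rfl⟩ := Finset.mem_image.1 hb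
  refine ⟨fun ν => (r ν : ℕ) + if ν = κ then (t : ℕ) else 0, fun _ => 0, ?_, ?_⟩
  · rw [fst_avgBonds_zero n ιA hιA, hιA]
    funext ν
    simp only [Pi.add_apply, Pi.sub_apply, Pi.single_apply, Nat.cast_zero, sub_zero, Nat.cast_add, Nat.cast_mul,
      Nat.cast_ite]
    split_ifs <;> ring
  · simp only [Finset.sum_const_zero, add_zero]
    rw [Finset.sum_add_distrib, Finset.sum_ite_eq' univ κ, if_pos (mem_univ κ)]
    have hr : ∀ ν, (r ν : ℕ) ≤ n - 1 := fun ν => Nat.le_sub_one_of_lt (r ν).isLt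
    have ht : (t : ℕ) ≤ n - 1 := Nat.le_sub_one_of_lt t.isLt
    calc ∑ ν, (r ν : ℕ) + (t : ℕ) ≤ ∑ _ν : Fin d, (n - 1) + (n - 1) :=
          Nat.add_le_add (Finset.sum_le_sum fun ν _ => hr ν) ht
      _ = (d + 1) * (n - 1) := by rw [sum_const, card_univ, Fintype.card_fin, smul_eq_mul]; ring

/-! ## §5 Toy: the incidence hypothesis is inhabited by the lambda; `d = 1`, `n = 2`, `M = 3` (elaboration only) -/

/-- Toy: on the `6`-cycle (`n = 2`, `M = 3`, `d = 1`) the average term at a coarse bond reads at most `2^{1+1}` fine bonds, for the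
incidence given by the defining lambda — junction by elaboration (instantiation only; no kernel arithmetic on `ZMod 6`). -/
example (j : (Fin 1 → ZMod 3) × Fin 1) : True := by
  have := card_image_avgBonds_le 2 (fun (j : (Fin 1 → ZMod 3) × Fin 1) (rt : (Fin 1 → Fin 2) × Fin 2) =>
    ((fun i => (((j.1 i).val * 2 + (rt.1 i : ℕ) : ℕ) : ZMod (2 * 3))) + Pi.single j.2 ((rt.2 : ℕ) : ZMod (2 * 3)), j.2)) j
  trivial

/-- Toy: the displacement letter of §4 for the same lambda (`D = (1+1)·(2−1)`), its `hιA` fed by `rfl` — junction by elaboration. -/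
example : True := by
  have := exists_displacement_avgBonds 2 (fun (j : (Fin 1 → ZMod 3) × Fin 1) (rt : (Fin 1 → Fin 2) × Fin 2) =>
    ((fun i => (((j.1 i).val * 2 + (rt.1 i : ℕ) : ℕ) : ZMod (2 * 3))) + Pi.single j.2 ((rt.2 : ℕ) : ZMod (2 * 3)), j.2))
    (fun _ _ _ _ => rfl)
  trivial

end Summit.QuantumFields.BalabanUV.T4Continuum.NE7b.TorusAverageIncidence
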